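import Literature.AlgebraicGeometry.AbelianSchemes.AbelianSchemeSymplecticLevel
import HarnessLib

/-!
# Re-indexing a symplectic lift of a level structure by a compatible tower of similitudes mod `M`

Topic `Literature/AlgebraicGeometry/AbelianSchemes`; namespace `Literature.AlgebraicGeometry.AbelianSchemes.AbelianSchemeOver`.
Adèle-free companion of ★ `AbelianSchemeSymplecticLevel` (D3): the action of `GSp_δ(ẑ)` on symplectic lifts
([Lan2013PELCompactifications] §1.3.6: `α̂ ↦ α̂ ∘ k`, `ν(α̂ ∘ k) = ν(α̂)·ν(k)`; [Deligne1971TravauxShimura] 4.12 (b) / 4.16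
«`k ↦ ḡ ∘ k`»), written over an abstract COMPATIBLE TOWER of matrices `κ_M ∈ M_{2g}(ℤ/M)` (`N ∣ M`), invertible,
trivial at level `N`, and similitudes of `E_δ mod M` with unit multipliers `u_M` (the shape of the image of `k ∈ K_δ(N)`
in `∏_M GL_{2g}(ℤ/M)`, supplied by ★ `ModuliOfAbelianVarieties/SiegelReindexTower`):

* `mulVecMulHom κ` — `x ↦ κ x` on `Multiplicative ((ℤ/M)^{2g})`, `mulVecMulHom_bijective`;
* `structure ReindexTower g N δ` — the data carrier (nothing asserted);
* `LevelStructure.SymplecticLift.reindex Λ T` — `lift′_M := lift_M ∘ κ_M`, `ζ′_M := ζ_M ^ u_M` (all eight clauses proved),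
  `reindex_lift_ofAdd` / `reindex_ζ` (rfl).

Cell `hodgecm-mathlib`, M1′ W-layer leaf (T2) (`MarkedBy.translateRight`), hoisted from the (P)-workfile § 6 (B-plan1 P39).
Banked generic leaf; HC_CM is proved only modulo the printed citations until rung 0 closes.

## References
* [Lan2013PELCompactifications] K.-W. Lan, *Arithmetic compactifications of PEL-type Shimura varieties* (2013), §1.3.6
  Def. 1.3.6.2 (p. 80), Lemma 1.3.6.5 (p. 81).
* [Deligne1971TravauxShimura] P. Deligne, *Travaux de Shimura* (1971), 4.12 (b) p. 149, 4.16 p. 150.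
-/

set_option autoImplicit false

universe u

noncomputable section

open CategoryTheory AlgebraicGeometry

namespace Literature.AlgebraicGeometry.AbelianSchemes

namespace AbelianSchemeOver

open Literature.AlgebraicGeometry.Motives
open scoped MonObj Matrix

variable {S : Scheme.{u}} {A : AbelianSchemeOver S} {g N : ℕ} {φ : A.LevelStructure g N} {Ω : Type u} [Field Ω]
  {s : Spec (.of Ω) ⟶ S} {Θ : CartierDivisor (A.fibre s).toAbelianVariety.X.left} {δ : Fin g → ℕ}

/-- Multiplication by a square matrix `κ` over `ℤ/M` on `(ℤ/M)^{2g}`, as a homomorphism of the multiplicative copies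
(the currency of `SymplecticLift.lift`). [cite: Lan2013PELCompactifications, §1.3.6 Def. 1.3.6.2 (p. 80)] -/
def mulVecMulHom {M : ℕ} (κ : Matrix (Fin g ⊕ Fin g) (Fin g ⊕ Fin g) (ZMod M)) :
    Multiplicative (Fin g ⊕ Fin g → ZMod M) →* Multiplicative (Fin g ⊕ Fin g → ZMod M) :=
  AddMonoidHom.toMultiplicative
    { toFun := fun x => κ *ᵥ x
      map_zero' := Matrix.mulVec_zero κ
      map_add' := fun x y => Matrix.mulVec_add κ x y }

/-- `mulVecMulHom κ (ofAdd x) = ofAdd (κ x)`. [cite: Lan2013PELCompactifications, §1.3.6 Def. 1.3.6.2 (p. 80)] -/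
@[simp] theorem mulVecMulHom_ofAdd {M : ℕ} (κ : Matrix (Fin g ⊕ Fin g) (Fin g ⊕ Fin g) (ZMod M))
    (x : Fin g ⊕ Fin g → ZMod M) :
    mulVecMulHom (g := g) κ (Multiplicative.ofAdd x) = Multiplicative.ofAdd (κ *ᵥ x) := rfl

/-- `mulVecMulHom` is bijective for a matrix with a two-sided inverse. [cite: Lan2013PELCompactifications, §1.3.6 (p. 80)] -/
theorem mulVecMulHom_bijective {M : ℕ} {κ κ' : Matrix (Fin g ⊕ Fin g) (Fin g ⊕ Fin g) (ZMod M)}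
    (h₁ : κ * κ' = 1) (h₂ : κ' * κ = 1) : Function.Bijective (mulVecMulHom (g := g) κ) := by
  refine Function.bijective_iff_has_inverse.2 ⟨mulVecMulHom κ', fun x => ?_, fun x => ?_⟩
  · change Multiplicative.ofAdd (κ' *ᵥ (κ *ᵥ Multiplicative.toAdd x)) = x
    rw [Matrix.mulVec_mulVec, h₂, Matrix.one_mulVec]; rfl
  · change Multiplicative.ofAdd (κ *ᵥ (κ' *ᵥ Multiplicative.toAdd x)) = x
    rw [Matrix.mulVec_mulVec, h₁, Matrix.one_mulVec]; rfl

/-- **A compatible tower of re-indexing data for symplectic lifts of level `N` and type `δ`**: matrices `κ_M` over `ℤ/M`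
with two-sided inverses `κinv_M` at every level `N ∣ M`, `M ≠ 0`, compatible with the reductions `ℤ/kM → ℤ/M`, EQUAL TO `1`
AT LEVEL `N`, and similitudes of `E_δ mod M` with multipliers `u_M` (units, compatible in the tower) — the shape of the image
of `k ∈ K_δ(N) ⊆ GSp_δ(ẑ)` in `∏_M GL_{2g}(ℤ/M)` (§B).  A data carrier for the HOME proof of (T2); nothing asserted.
[cite: Lan2013PELCompactifications, §1.3.6 Def. 1.3.6.2 (p. 80) and Lemma 1.3.6.5 (p. 81)] [cite: Deligne1971TravauxShimura, 4.16 p. 150] -/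
structure ReindexTower (g N : ℕ) (δ : Fin g → ℕ) where
  /-- the matrices `κ_M ∈ M_{2g}(ℤ/M)` -/
  κ : (M : ℕ) → Matrix (Fin g ⊕ Fin g) (Fin g ⊕ Fin g) (ZMod M)
  /-- their inverses -/
  κinv : (M : ℕ) → Matrix (Fin g ⊕ Fin g) (Fin g ⊕ Fin g) (ZMod M)
  /-- the multipliers `u_M ∈ ℤ/M` -/
  u : (M : ℕ) → ZMod M
  /-- `κ_M κinv_M = 1` -/
  κ_mul_κinv : ∀ ⦃M : ℕ⦄, N ∣ M → M ≠ 0 → κ M * κinv M = 1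
  /-- `κinv_M κ_M = 1` -/
  κinv_mul_κ : ∀ ⦃M : ℕ⦄, N ∣ M → M ≠ 0 → κinv M * κ M = 1
  /-- compatibility with `ℤ/kM → ℤ/M` -/
  κ_compat : ∀ ⦃M : ℕ⦄ (k : ℕ), N ∣ M → M ≠ 0 → k ≠ 0 →
    (κ (k * M)).map (ZMod.castHom (Dvd.intro_left k rfl) (ZMod M)) = κ M
  /-- trivial at level `N` -/
  κ_level : κ N = 1
  /-- the multipliers are units -/
  isUnit_u : ∀ ⦃M : ℕ⦄, N ∣ M → M ≠ 0 → IsUnit (u M)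
  /-- compatibility of the multipliers in the tower -/
  u_compat : ∀ ⦃M : ℕ⦄ (k : ℕ), N ∣ M → M ≠ 0 → k ≠ 0 → ZMod.castHom (Dvd.intro_left k rfl) (ZMod M) (u (k * M)) = u M
  /-- `κ_M` is a similitude of `E_δ mod M` with multiplier `u_M` -/
  κ_form : ∀ ⦃M : ℕ⦄, N ∣ M → M ≠ 0 → ∀ x y : Fin g ⊕ Fin g → ZMod M,
    typeFormMod δ M (κ M *ᵥ x) (κ M *ᵥ y) = u M * typeFormMod δ M x y

/-- `ζ ^ a = ζ ^ (a mod M)` when `ζ ^ M = 1`. [cite: Lan2013PELCompactifications, §1.3.6 Lemma 1.3.6.5 (p. 81)] -/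
theorem pow_eq_pow_mod_of_pow_eq_one {R : Type*} [Monoid R] {ζ : R} {M : ℕ} (hζ : ζ ^ M = 1) (a : ℕ) :
    ζ ^ a = ζ ^ (a % M) := by
  conv_lhs => rw [← Nat.div_add_mod a M, pow_add, pow_mul, hζ, one_pow, one_mul]

/-- `ζ ^ (a mod M).val = ζ ^ a.val` for `a ∈ ℤ/kM` when `ζ ^ M = 1`. [cite: Lan2013PELCompactifications, §1.3.6 Lemma 1.3.6.5 (p. 81)] -/
theorem pow_val_castHom_eq {R : Type*} [Monoid R] {ζ : R} {M k : ℕ} (hM : M ≠ 0) (hk : k ≠ 0) (hζ : ζ ^ M = 1)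
    (a : ZMod (k * M)) : ζ ^ (ZMod.castHom (Dvd.intro_left k rfl) (ZMod M) a).val = ζ ^ a.val := by
  haveI : NeZero (k * M) := ⟨mul_ne_zero hk hM⟩
  rw [ZMod.castHom_apply, ZMod.cast_eq_val, ZMod.val_natCast, ← pow_eq_pow_mod_of_pow_eq_one hζ]

/-- `ζ ^ (a * b).val = (ζ ^ a.val) ^ b.val` in `ℤ/M` when `ζ ^ M = 1`. [cite: Lan2013PELCompactifications, §1.3.6 Lemma 1.3.6.5 (p. 81)] -/
theorem pow_val_mul_eq {R : Type*} [Monoid R] {ζ : R} {M : ℕ} (hζ : ζ ^ M = 1) (a b : ZMod M) :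
    ζ ^ (a * b).val = (ζ ^ a.val) ^ b.val := by
  rw [ZMod.val_mul, ← pow_eq_pow_mod_of_pow_eq_one hζ, pow_mul]

namespace LevelStructure.SymplecticLift

variable (Λ : φ.SymplecticLift s Θ δ) (T : ReindexTower g N δ)

/-- **RE-INDEXING a symplectic lift by a compatible tower `T` (the action of `GSp_δ(ẑ)` on symplectic lifts,
[Lan2013PELCompactifications] §1.3.6: `α̂ ↦ α̂ ∘ k`, `ν ↦ ν·ν(k)`)**: `lift′_M := lift_M ∘ κ_M`, `ζ′_M := ζ_M ^ u_M`;
bijective (the `κ_M` are invertible), tower-compatible (the `κ_M` are), EQUAL TO `φ(s)` AT LEVEL `N` (`κ_N = 1`), and a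
symplectic similitude at every level with the new roots `ζ_M ^ u_M` (`E_δ(κx, κy) = u_M E_δ(x, y)`).
[cite: Lan2013PELCompactifications, §1.3.6 Def. 1.3.6.2 (p. 80) and Lemma 1.3.6.5 (p. 81)] [cite: Deligne1971TravauxShimura, 4.12 (b) p. 149 and 4.16 p. 150] -/
def reindex : φ.SymplecticLift s Θ δ where
  ζ M := Λ.ζ M ^ (T.u M).val
  isPrimitiveRoot_ζ M hM hM₀ := by
    haveI : NeZero M := ⟨hM₀⟩
    obtain ⟨w, hw⟩ := T.isUnit_u hM hM₀
    rw [← hw]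
    exact (Λ.isPrimitiveRoot_ζ hM hM₀).pow_of_coprime _ (ZMod.val_coe_unit_coprime w)
  ζ_pow M k hM hM₀ hk := by
    rw [pow_right_comm, Λ.ζ_pow k hM hM₀ hk, ← T.u_compat k hM hM₀ hk,
      pow_val_castHom_eq hM₀ hk (Λ.ζ_pow_eq_one hM hM₀)]
  lift M := (Λ.lift M).comp (mulVecMulHom (T.κ M))
  lift_bijective M hM hM₀ :=
    (Λ.lift_bijective hM hM₀).comp (mulVecMulHom_bijective (T.κ_mul_κinv hM hM₀) (T.κinv_mul_κ hM hM₀))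
  lift_compat M k x hM hM₀ hk := by
    change ((Λ.lift M (mulVecMulHom (T.κ M) (Multiplicative.ofAdd _)) : (A.fibre s).toAbelianVariety.Points Ω)) =
      ((Λ.lift (k * M) (mulVecMulHom (T.κ (k * M)) (Multiplicative.ofAdd x))) : (A.fibre s).toAbelianVariety.Points Ω) ^ k
    have hx : (T.κ M *ᵥ fun i => ZMod.castHom (Dvd.intro_left k rfl) (ZMod M) (x i)) =
        fun i => ZMod.castHom (Dvd.intro_left k rfl) (ZMod M) ((T.κ (k * M) *ᵥ x) i) := by
      funext i
      rw [← T.κ_compat k hM hM₀ hk, RingHom.map_mulVec]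
      rfl
    rw [mulVecMulHom_ofAdd, mulVecMulHom_ofAdd, ← Λ.lift_compat k (T.κ (k * M) *ᵥ x) hM hM₀ hk, hx]
  lift_level i := by
    change ((Λ.lift N (mulVecMulHom (T.κ N) (Multiplicative.ofAdd (Pi.single i 1)))) :
      (A.fibre s).toAbelianVariety.Points Ω) = A.restrictPt s (φ.σ i)
    rw [mulVecMulHom_ofAdd, T.κ_level, Matrix.one_mulVec]
    exact Λ.lift_level i
  pairing M hM hMΩ x y := by
    have hM₀ : M ≠ 0 := by rintro rfl; exact hMΩ Nat.cast_zero
    haveI := AbelianVariety.isDominant_toSchemeHom_zsmul_of_ne_zero (A.fibre s).toAbelianVariety hMΩ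
    change (A.fibre s).toAbelianVariety.weilPairingLevel Θ (Λ.lift M (mulVecMulHom (T.κ M) (Multiplicative.ofAdd x)))
        (Λ.lift M (mulVecMulHom (T.κ M) (Multiplicative.ofAdd y))) = (Λ.ζ M ^ (T.u M).val) ^ (typeFormMod δ M x y).val
    rw [mulVecMulHom_ofAdd, mulVecMulHom_ofAdd, Λ.weilPairingLevel_lift hM hMΩ, T.κ_form hM hM₀,
      pow_val_mul_eq (Λ.ζ_pow_eq_one hM hM₀)]

/-- The re-indexed tower is `lift_M ∘ κ_M`. [cite: Lan2013PELCompactifications, §1.3.6 Def. 1.3.6.2 (p. 80)] -/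
theorem reindex_lift_ofAdd (M : ℕ) (x : Fin g ⊕ Fin g → ZMod M) :
    (Λ.reindex T).lift M (Multiplicative.ofAdd x) = Λ.lift M (Multiplicative.ofAdd (T.κ M *ᵥ x)) := rfl

/-- The re-indexed roots are `ζ_M ^ u_M`. [cite: Lan2013PELCompactifications, §1.3.6 Lemma 1.3.6.5 (p. 81)] -/
theorem reindex_ζ (M : ℕ) : (Λ.reindex T).ζ M = Λ.ζ M ^ (T.u M).val := rfl

end LevelStructure.SymplecticLift

end AbelianSchemeOver

end Literature.AlgebraicGeometry.AbelianSchemes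

end
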